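import Summits.QuantumFields.YangMills.Theorems.SwapVirialDeficitSectorLaplaceTipOrigFibre
import Summits.QuantumFields.YangMills.Theorems.SwapVirialDeficitSectorLaplaceEndLeaderFubini
import Summits.QuantumFields.YangMills.Theorems.SwapVirialDeficitBlowUpGnomonicFollowerWeightMass
import Summits.QuantumFields.YangMills.Theorems.SwapVirialDeficitSectorLaplaceEndGaussTails
import HarnessLib

/-!
# F6-ORIG, FIRST LAYER: the `z`-integrated leader bound on the small-leader region ORIG of w2 g61's aligned-rotation assembly
# (cell ym-idea-1, skeleton ➎ v14, `stub_core_tip`, socket (hCore) → `hLLm` → region socket `leaderLayer_ORIG`; LEAD seat ym-line-sfw-p2 g100, free-hands support of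
# ⟨stmt-QuantumFields-24197⟩ `SwapVirialDeficit.SwapGluedStiffness`)

At a leader pair `(x, y)` with `|x|², |y|² ≤ s² = (1+δt²)⁻¹` (`δt ≥ 1`): (i) the floor of ✓`tipFibre_ORIG` dominates three FREE Gaussians,
`Λ ≥ (s²(x₁²+x₂²) + s²(y₁²+y₂²) + |z|²/(1+|z|²))/(14400L⁶)` (`tipOrig_floor_le`: `4δt²s⁴/(1+|x|²) ≥ s²`, `4s²/(1+|y|²) ≥ s²`, cross terms dropped); (ii) the
`z`-letter integrates by ✓`SigmaBall.lintegral_zLetter_pi_le` (`Z_c = 2C₃/((1+β)√(1+β))`, `β = b/(14400L⁶)`) and ✓`lintegral_gnomonicWeight` (`= π²`); the weights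
`w(x) ≤ (1+x₀²)⁻¹` deliver the apexRef weight at `p′ = (x₀, y₀)`.
★★ `tipOrig_zLayer_le` — `∫⁻_z ofReal(w(x)w(y)w(z))·∫⁻_F e^{−bF̂}π ≤ ofReal(w₀(p′)/√det A₀(gnoBase p′) · e^{3/2}G_b·Z_c)·E(x⊥)E(y⊥) + ofReal(w(x)w(y)·T)`,
`E(u) = ofReal(e^{−βs²|u|²})`, `T = e^{−bκ_R}·I_W·Z_c + e^{−b·rate}·e^{60L⁴}·π²` — the integrand of the base layer (next file, with g49's leader-pair split).

HONEST LABEL: one layer of bookkeeping; `leaderLayer_ORIG`, `hLLm`, (hCore), `stub_core_tip`, ⟨24197⟩ ∕ ⟨24194⟩ OPEN; own crux ⟨22884⟩ `LargeFieldMassRefinementTail` OPEN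
(blocked-on ⟨19935⟩); the Yang–Mills mass gap is NOT proved; no summit is proved by a line.  THEOREMS ONLY (0 `def`, 0 `sorry`, no instance, no notation), standard axioms.
`--supports stmt-QuantumFields-24197`.  References: [cite: Luscher1983, §2]; [folklore].
-/

set_option autoImplicit false
set_option synthInstance.maxSize 1024

noncomputable section

open MeasureTheory Quaternion Set Module
open scoped Quaternion BigOperators ENNReal InnerProductSpace
open Literature.MathematicalPhysics.QuantumLattice
open Literature.MathematicalPhysics.QuantumFieldTheory hiding SU2

namespace Summit.QuantumFields.YangMills.Theorems.SwapVirialDeficit.SectorLaplace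

open Summit.QuantumFields.YangMills.Theorems.FemtoTransferGap
open Summit.QuantumFields.YangMills.Theorems.FemtoTransferGap.TT
open Summit.QuantumFields.YangMills.Theorems.VirialFluxGap.RingDeficit
open Summit.QuantumFields.YangMills.Theorems.SwapVirialDeficit.SwapRing
open Summit.QuantumFields.YangMills.Theorems.SwapVirialDeficit.BlowUpRing
open Summit.QuantumFields.YangMills.Theorems.SwapVirialDeficit.Gnomonic (piWeight piWeight_pos piWeight_le_one gnomonicWeight gnomonicWeight_pos gnomonicWeight_le_one normSq3)
open Summit.QuantumFields.YangMills.Theorems.SwapVirialDeficit.SigmaBall (lintegral_zLetter_pi_le normSq3_eq)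

variable {L : ℕ} [NeZero L]

/-! ## §1 The floor on ORIG dominates three free Gaussians -/

omit [NeZero L] in
/-- On ORIG (`x₀²+x₁²+x₂², y₀²+y₁²+y₂² ≤ s² = (1+δt²)⁻¹`, `1 ≤ δt`) the leader floor of ✓`tipFibre_ORIG` satisfies
`s²(x₁²+x₂²) + s²(y₁²+y₂²) + |z|²/(1+|z|²) ≤ Four ≤ 14400L⁶·Λ`. [folklore] -/
theorem tipOrig_floor_le {δt : ℝ} (hδt : 1 ≤ δt) (Lr : ℝ) (hLr : 0 < Lr) (x y z : Fin 3 → ℝ)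
    (hx : (x 0) ^ 2 + (x 1) ^ 2 + (x 2) ^ 2 ≤ (1 + δt ^ 2)⁻¹) (hy : (y 0) ^ 2 + (y 1) ^ 2 + (y 2) ^ 2 ≤ (1 + δt ^ 2)⁻¹) :
    ((1 + δt ^ 2)⁻¹ * ((x 1) ^ 2 + (x 2) ^ 2) + (1 + δt ^ 2)⁻¹ * ((y 1) ^ 2 + (y 2) ^ 2) +
        ((z 0) ^ 2 + (z 1) ^ 2 + (z 2) ^ 2) / (1 + ((z 0) ^ 2 + (z 1) ^ 2 + (z 2) ^ 2))) / (14400 * Lr ^ 6) ≤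
      (4 * δt ^ 2 * ((1 + δt ^ 2)⁻¹) ^ 2 * ((x 1) ^ 2 + (x 2) ^ 2) / (1 + ((x 0) ^ 2 + (x 1) ^ 2 + (x 2) ^ 2)) +
          4 * (1 + δt ^ 2)⁻¹ * ((y 1) ^ 2 + (y 2) ^ 2) / (1 + ((y 0) ^ 2 + (y 1) ^ 2 + (y 2) ^ 2)) +
          4 * ((x 2 * y 0 - x 0 * y 2) ^ 2 + (x 0 * y 1 - x 1 * y 0) ^ 2) / ((1 + ((x 0) ^ 2 + (x 1) ^ 2 + (x 2) ^ 2)) * (1 + ((y 0) ^ 2 + (y 1) ^ 2 + (y 2) ^ 2))) +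
          ((z 0) ^ 2 + (z 1) ^ 2 + (z 2) ^ 2) / (1 + ((z 0) ^ 2 + (z 1) ^ 2 + (z 2) ^ 2))) / (14400 * Lr ^ 6) +
      4 * ((x 1 * y 2 - x 2 * y 1) ^ 2 + (x 2 * y 0 - x 0 * y 2) ^ 2 + (x 0 * y 1 - x 1 * y 0) ^ 2) /
          ((1 + ((x 0) ^ 2 + (x 1) ^ 2 + (x 2) ^ 2)) * (1 + ((y 0) ^ 2 + (y 1) ^ 2 + (y 2) ^ 2))) / (3600 * Lr ^ 6) := by
  set s2 : ℝ := (1 + δt ^ 2)⁻¹ with hs2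
  set X : ℝ := (x 0) ^ 2 + (x 1) ^ 2 + (x 2) ^ 2 with hX
  set Y : ℝ := (y 0) ^ 2 + (y 1) ^ 2 + (y 2) ^ 2 with hY
  have hT : 0 < 1 + δt ^ 2 := by positivity
  have hs20 : 0 < s2 := by positivity
  have hs21 : s2 ≤ 1 := by rw [hs2]; exact inv_le_one_of_one_le₀ (by nlinarith)
  have hX0 : 0 ≤ X := by positivity
  have hY0 : 0 ≤ Y := by positivity
  have hX1 : X ≤ 1 := hx.trans hs21
  have hY1 : Y ≤ 1 := hy.trans hs21
  have hxp : 0 ≤ (x 1) ^ 2 + (x 2) ^ 2 := by positivity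
  have hyp : 0 ≤ (y 1) ^ 2 + (y 2) ^ 2 := by positivity
  -- `δt² s2 ≥ 1/2`
  have hds : 1 / 2 ≤ δt ^ 2 * s2 := by
    rw [hs2, ← div_eq_mul_inv, le_div_iff₀ hT]; nlinarith
  -- T1 ≥ s2·x⊥²
  have h1 : s2 * ((x 1) ^ 2 + (x 2) ^ 2) ≤ 4 * δt ^ 2 * s2 ^ 2 * ((x 1) ^ 2 + (x 2) ^ 2) / (1 + X) := by
    rw [le_div_iff₀ (by linarith)]
    have : s2 * ((x 1) ^ 2 + (x 2) ^ 2) * (1 + X) ≤ s2 * ((x 1) ^ 2 + (x 2) ^ 2) * 2 := by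
      apply mul_le_mul_of_nonneg_left (by linarith) (by positivity)
    have h4 : s2 * ((x 1) ^ 2 + (x 2) ^ 2) * 2 ≤ 4 * δt ^ 2 * s2 ^ 2 * ((x 1) ^ 2 + (x 2) ^ 2) := by
      have e : 4 * δt ^ 2 * s2 ^ 2 * ((x 1) ^ 2 + (x 2) ^ 2) = (δt ^ 2 * s2) * (4 * (s2 * ((x 1) ^ 2 + (x 2) ^ 2))) := by ring
      rw [e]; nlinarith [mul_nonneg hs20.le hxp]
    linarith
  -- T2 ≥ s2·y⊥²
  have h2 : s2 * ((y 1) ^ 2 + (y 2) ^ 2) ≤ 4 * s2 * ((y 1) ^ 2 + (y 2) ^ 2) / (1 + Y) := by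
    rw [le_div_iff₀ (by linarith)]
    nlinarith [mul_nonneg hs20.le hyp]
  -- T3, Cross ≥ 0
  have h3 : 0 ≤ 4 * ((x 2 * y 0 - x 0 * y 2) ^ 2 + (x 0 * y 1 - x 1 * y 0) ^ 2) / ((1 + X) * (1 + Y)) := by positivity
  have hC : 0 ≤ 4 * ((x 1 * y 2 - x 2 * y 1) ^ 2 + (x 2 * y 0 - x 0 * y 2) ^ 2 + (x 0 * y 1 - x 1 * y 0) ^ 2) / ((1 + X) * (1 + Y)) / (3600 * Lr ^ 6) := by
    positivity
  have hL6 : 0 < 14400 * Lr ^ 6 := by positivity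
  have hmain : s2 * ((x 1) ^ 2 + (x 2) ^ 2) + s2 * ((y 1) ^ 2 + (y 2) ^ 2) +
      ((z 0) ^ 2 + (z 1) ^ 2 + (z 2) ^ 2) / (1 + ((z 0) ^ 2 + (z 1) ^ 2 + (z 2) ^ 2)) ≤
      4 * δt ^ 2 * s2 ^ 2 * ((x 1) ^ 2 + (x 2) ^ 2) / (1 + X) + 4 * s2 * ((y 1) ^ 2 + (y 2) ^ 2) / (1 + Y) +
        4 * ((x 2 * y 0 - x 0 * y 2) ^ 2 + (x 0 * y 1 - x 1 * y 0) ^ 2) / ((1 + X) * (1 + Y)) +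
        ((z 0) ^ 2 + (z 1) ^ 2 + (z 2) ^ 2) / (1 + ((z 0) ^ 2 + (z 1) ^ 2 + (z 2) ^ 2)) := by linarith
  have := div_le_div_of_nonneg_right hmain hL6.le
  linarith

omit [NeZero L] in
/-- The gnomonic weight is below the axial base weight: `w(x) ≤ (1 + x₀²)⁻¹`. [folklore] -/
theorem gnomonicWeight_le_base (x : Fin 3 → ℝ) : gnomonicWeight x ≤ (1 + (x 0) ^ 2)⁻¹ := by
  have hN : (x 0) ^ 2 ≤ normSq3 x := by
    rw [normSq3_eq x]; nlinarith [sq_nonneg (x 1), sq_nonneg (x 2)]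
  have hN0 : 0 ≤ normSq3 x := by rw [normSq3_eq x]; positivity
  calc gnomonicWeight x = (1 + normSq3 x)⁻¹ * (1 + normSq3 x)⁻¹ := by unfold gnomonicWeight; ring
    _ ≤ (1 + normSq3 x)⁻¹ * 1 := by
        apply mul_le_mul_of_nonneg_left (inv_le_one_of_one_le₀ (by linarith)) (by positivity)
    _ ≤ (1 + (x 0) ^ 2)⁻¹ := by rw [mul_one]; exact inv_anti₀ (by positivity) (by linarith)

/-! ## §2 The `z`-layer -/

set_option maxHeartbeats 1600000 in
/-- ★★ **F6-ORIG, `z`-LAYER**: at a leader pair in ORIG, the `z`-integral of `w(x)w(y)w(z)·(fibre integral)` is bounded by the apexRef weight at `p′ = (x₀, y₀)`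
times two free plane Gaussians in `x⊥, y⊥`, plus a `w(x)w(y)`-integrable tail. [cite: Luscher1983, §2] -/
theorem tipOrig_zLayer_le {ε : GnoSign L} (hε : GoodSign ε) {δt : ℝ} (hδt : 1 ≤ δt)
    (hwinδ : 122689728 * δt⁻¹ * (L : ℝ) ^ 4 ≤ (2304 * (L : ℝ) ^ 6 * (Fintype.card (Fol L) : ℝ))⁻¹ / (8 * (3 * (Fintype.card (Fol L) : ℝ))))
    {A0 : GnoCoord L → GnoFol L →ₗ[ℝ] GnoFol L} (hA0s : ∀ η, (A0 η).IsSymmetric)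
    (hA0yy : ∀ η (y : GnoFol L), ⟪A0 η y, y⟫_ℝ = iteratedFDeriv ℝ 2 (fun y' : GnoFol L => gnoDeficit z₀ (fun _ => 1) ((1 : ℝ) : ℍ) ε (η + gnoFolEmb y')) 0 (fun _ => y))
    (hA0ray : ∀ η (y : GnoFol L), ⟪A0 η y, y⟫_ℝ = iteratedDeriv 2 (fun s : ℝ => gnoDeficit (fun _ => false) (fun _ => 1) ((1 : ℝ) : ℍ) ε (η + s • gnoFolEmb y)) 0)
    (hA0amb : ∀ η (y : GnoFol L), ⟪A0 η y, y⟫_ℝ = iteratedFDeriv ℝ 2 (gnoDeficit z₀ (fun _ => 1) ((1 : ℝ) : ℍ) ε) η (fun _ => gnoFolEmb y))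
    (x y : Fin 3 → ℝ) {sT κf : ℝ} (hsT : 0 ≤ sT) (hκf0 : 0 ≤ κf)
    (hs2 : sT ^ 2 ≤ ((2304 * (L : ℝ) ^ 6 * (Fintype.card (Fol L) : ℝ))⁻¹) ^ 2 / (304992000000 * (L : ℝ) ^ 8))
    (hκf : κf ≤ (2304 * (L : ℝ) ^ 6 * (Fintype.card (Fol L) : ℝ))⁻¹ * ((2304 * (L : ℝ) ^ 6 * (Fintype.card (Fol L) : ℝ))⁻¹ / (6 * (2484000 * (L : ℝ) ^ 4))) ^ 2 / 4)
    (hκwin : 44712000 * (L : ℝ) ^ 4 * Real.sqrt (κf / (2304 * (L : ℝ) ^ 6 * (Fintype.card (Fol L) : ℝ))⁻¹) ≤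
      (2304 * (L : ℝ) ^ 6 * (Fintype.card (Fol L) : ℝ))⁻¹ / (8 * (3 * (Fintype.card (Fol L) : ℝ))))
    (hx : (x 0) ^ 2 + (x 1) ^ 2 + (x 2) ^ 2 ≤ (1 + δt ^ 2)⁻¹) (hy : (y 0) ^ 2 + (y 1) ^ 2 + (y 2) ^ 2 ≤ (1 + δt ^ 2)⁻¹)
    {ω : ℝ} (hω0 : 0 < ω) (hω1 : ω ≤ 1)
    (hωwin : 3219264 * (L : ℝ) ^ 4 * ω ≤ (2304 * (L : ℝ) ^ 6 * (Fintype.card (Fol L) : ℝ))⁻¹ / (4 * (3 * (Fintype.card (Fol L) : ℝ))))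
    (hsω : (1 + δt ^ 2)⁻¹ ≤ ω ^ 2 / 32) (hθω : 2 * (7200 * (L : ℝ) ^ 6 * κf) ≤ ω ^ 2 / 16)
    {b : ℝ} (hb : 0 < b) :
    ∫⁻ z : Fin 3 → ℝ, ENNReal.ofReal (gnomonicWeight x * gnomonicWeight y * gnomonicWeight z) *
        ∫⁻ F : Fol L → Fin 3 → ℝ, ENNReal.ofReal (Real.exp (-(b * gnoDeficit (fun _ => false) (fun _ => 1) (hubAt δt 1) ε (((x, y), (z, F)) : GnoCoord L))) * piWeight F) ≤
      ENNReal.ofReal ((1 + (x 0) ^ 2)⁻¹ * (1 + (y 0) ^ 2)⁻¹ / Real.sqrt (LinearMap.det (A0 (gnoBase (x 0) (y 0)))) *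
            (Real.exp (3 / 2) * (2 * Real.pi / ((1 - 1 / (2 * (finrank ℝ (GnoFol L) : ℝ))) * b)) ^ ((finrank ℝ (GnoFol L) : ℝ) / 2) *
              (2 * (∫ w : EuclideanSpace ℝ (Fin 3), ((1 + ‖w‖ ^ 2) ^ 2)⁻¹) / ((1 + b / (14400 * (L : ℝ) ^ 6)) * Real.sqrt (1 + b / (14400 * (L : ℝ) ^ 6)))))) *
          (ENNReal.ofReal (Real.exp (-(b / (14400 * (L : ℝ) ^ 6) * (1 + δt ^ 2)⁻¹ * ((x 1) ^ 2 + (x 2) ^ 2)))) *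
            ENNReal.ofReal (Real.exp (-(b / (14400 * (L : ℝ) ^ 6) * (1 + δt ^ 2)⁻¹ * ((y 1) ^ 2 + (y 2) ^ 2))))) +
        ENNReal.ofReal (gnomonicWeight x * gnomonicWeight y *
          (Real.exp (-(b * ((2304 * (L : ℝ) ^ 6 * (Fintype.card (Fol L) : ℝ))⁻¹ *
                (3 * ((2304 * (L : ℝ) ^ 6 * (Fintype.card (Fol L) : ℝ))⁻¹ / 2) / (2 * (finrank ℝ (GnoFol L) : ℝ) * (2484000 * (L : ℝ) ^ 4))) ^ 2 / 4))) *
              (∫ w : GnoFol L, piWeight (gnoFolBlocks w)) *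
              (2 * (∫ w : EuclideanSpace ℝ (Fin 3), ((1 + ‖w‖ ^ 2) ^ 2)⁻¹) / ((1 + b / (14400 * (L : ℝ) ^ 6)) * Real.sqrt (1 + b / (14400 * (L : ℝ) ^ 6)))) +
            Real.exp (-(b * (min (sT ^ 2) (κf / (300 * (L : ℝ) ^ 4)) / (3600 * (L : ℝ) ^ 6)))) * Real.exp (60 * (L : ℝ) ^ 4) * Real.pi ^ 2)) := by
  have hL1 : (1 : ℝ) ≤ (L : ℝ) := by exact_mod_cast NeZero.one_le
  have hL0 : (0 : ℝ) < (L : ℝ) := by linarith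
  have hδt0 : 0 < δt := by linarith
  -- abbreviations (real numbers)
  set β : ℝ := b / (14400 * (L : ℝ) ^ 6) with hβ
  have hβ0 : 0 < β := by positivity
  set s2 : ℝ := (1 + δt ^ 2)⁻¹ with hs2def
  set C3 : ℝ := ∫ w : EuclideanSpace ℝ (Fin 3), ((1 + ‖w‖ ^ 2) ^ 2)⁻¹ with hC3
  set Zc : ℝ := 2 * C3 / ((1 + β) * Real.sqrt (1 + β)) with hZc
  set Gb : ℝ := (2 * Real.pi / ((1 - 1 / (2 * (finrank ℝ (GnoFol L) : ℝ))) * b)) ^ ((finrank ℝ (GnoFol L) : ℝ) / 2) with hGb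
  set Dref : ℝ := Real.sqrt (LinearMap.det (A0 (gnoBase (x 0) (y 0)))) with hDref
  set κR : ℝ := (2304 * (L : ℝ) ^ 6 * (Fintype.card (Fol L) : ℝ))⁻¹ *
      (3 * ((2304 * (L : ℝ) ^ 6 * (Fintype.card (Fol L) : ℝ))⁻¹ / 2) / (2 * (finrank ℝ (GnoFol L) : ℝ) * (2484000 * (L : ℝ) ^ 4))) ^ 2 / 4 with hκR
  set IW : ℝ := ∫ w : GnoFol L, piWeight (gnoFolBlocks w) with hIW
  set rate : ℝ := min (sT ^ 2) (κf / (300 * (L : ℝ) ^ 4)) / (3600 * (L : ℝ) ^ 6) with hrate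
  set Ex : ℝ := Real.exp (-(β * s2 * ((x 1) ^ 2 + (x 2) ^ 2))) with hEx
  set Ey : ℝ := Real.exp (-(β * s2 * ((y 1) ^ 2 + (y 2) ^ 2))) with hEy
  have hC30 : 0 ≤ C3 := by rw [hC3]; exact integral_nonneg fun w => by positivity
  have hZc0 : 0 ≤ Zc := by positivity
  have hGb0 : 0 ≤ Gb := by
    rw [hGb]
    have hd : (2 : ℝ) ≤ (finrank ℝ (GnoFol L) : ℝ) := by
      rw [finrank_gnoFol_real (L := L)]
      have hc1 : (1 : ℝ) ≤ (Fintype.card (Fol L) : ℝ) := by exact_mod_cast one_le_card_fol (L := L)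
      linarith
    have h1 : 0 ≤ 1 - 1 / (2 * (finrank ℝ (GnoFol L) : ℝ)) := by
      rw [sub_nonneg, div_le_one (by positivity)]; linarith
    exact Real.rpow_nonneg (by positivity) _
  have hDref0 : 0 ≤ Dref := Real.sqrt_nonneg _
  have hIW0 : 0 ≤ IW := by rw [hIW]; exact integral_nonneg fun w => (piWeight_pos _).le
  have hEx1 : Ex ≤ 1 := by rw [hEx]; exact Real.exp_le_one_iff.2 (by nlinarith [mul_pos hβ0 (by positivity : (0:ℝ) < s2), sq_nonneg (x 1), sq_nonneg (x 2)])
  have hEy1 : Ey ≤ 1 := by rw [hEy]; exact Real.exp_le_one_iff.2 (by nlinarith [mul_pos hβ0 (by positivity : (0:ℝ) < s2), sq_nonneg (y 1), sq_nonneg (y 2)])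
  have hEx0 : 0 ≤ Ex := (Real.exp_pos _).le
  have hEy0 : 0 ≤ Ey := (Real.exp_pos _).le
  have hwx := gnomonicWeight_le_base x
  have hwy := gnomonicWeight_le_base y
  have hwx0 : 0 ≤ gnomonicWeight x := (gnomonicWeight_pos x).le
  have hwy0 : 0 ≤ gnomonicWeight y := (gnomonicWeight_pos y).le
  -- the pointwise bound in `z`
  have hxperp : (x 1) ^ 2 + (x 2) ^ 2 ≤ (1 + δt ^ 2)⁻¹ := le_trans (by nlinarith [sq_nonneg (x 0)]) hx
  have hyperp : (y 1) ^ 2 + (y 2) ^ 2 ≤ (1 + δt ^ 2)⁻¹ := le_trans (by nlinarith [sq_nonneg (y 0)]) hy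
  have hpt : ∀ z : Fin 3 → ℝ,
      ENNReal.ofReal (gnomonicWeight x * gnomonicWeight y * gnomonicWeight z) *
        ∫⁻ F : Fol L → Fin 3 → ℝ, ENNReal.ofReal (Real.exp (-(b * gnoDeficit (fun _ => false) (fun _ => 1) (hubAt δt 1) ε (((x, y), (z, F)) : GnoCoord L))) * piWeight F) ≤
      ENNReal.ofReal (gnomonicWeight x * gnomonicWeight y * Ex * Ey * (Real.exp (3 / 2) * Gb / Dref + Real.exp (-(b * κR)) * IW)) *
          ENNReal.ofReal (gnomonicWeight z * Real.exp (-(β * normSq3 z / (1 + normSq3 z)))) +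
        (ENNReal.ofReal (gnomonicWeight x * gnomonicWeight y) * ENNReal.ofReal (Real.exp (-(b * rate)))) *
          (ENNReal.ofReal (gnomonicWeight z) * ∫⁻ F : Fol L → Fin 3 → ℝ, ENNReal.ofReal (piWeight F)) := by
    intro z
    have hfib := tipFibre_ORIG (L := L) hε hδt0 hwinδ hA0s hA0yy hA0ray hA0amb x y z hsT hκf0 hs2 hκf hκwin hxperp hyperp hω0 hω1 hωwin hsω hθω hb
    have hfloor := tipOrig_floor_le hδt (L : ℝ) hL0 x y z hx hy
    -- exponential of the floor
    have hzN : (z 0) ^ 2 + (z 1) ^ 2 + (z 2) ^ 2 = normSq3 z := (normSq3_eq z).symm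
    have hexp : Real.exp (-(b * ((4 * δt ^ 2 * ((1 + δt ^ 2)⁻¹) ^ 2 * ((x 1) ^ 2 + (x 2) ^ 2) / (1 + ((x 0) ^ 2 + (x 1) ^ 2 + (x 2) ^ 2)) +
          4 * (1 + δt ^ 2)⁻¹ * ((y 1) ^ 2 + (y 2) ^ 2) / (1 + ((y 0) ^ 2 + (y 1) ^ 2 + (y 2) ^ 2)) +
          4 * ((x 2 * y 0 - x 0 * y 2) ^ 2 + (x 0 * y 1 - x 1 * y 0) ^ 2) / ((1 + ((x 0) ^ 2 + (x 1) ^ 2 + (x 2) ^ 2)) * (1 + ((y 0) ^ 2 + (y 1) ^ 2 + (y 2) ^ 2))) +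
          ((z 0) ^ 2 + (z 1) ^ 2 + (z 2) ^ 2) / (1 + ((z 0) ^ 2 + (z 1) ^ 2 + (z 2) ^ 2))) / (14400 * (L : ℝ) ^ 6) +
        4 * ((x 1 * y 2 - x 2 * y 1) ^ 2 + (x 2 * y 0 - x 0 * y 2) ^ 2 + (x 0 * y 1 - x 1 * y 0) ^ 2) /
          ((1 + ((x 0) ^ 2 + (x 1) ^ 2 + (x 2) ^ 2)) * (1 + ((y 0) ^ 2 + (y 1) ^ 2 + (y 2) ^ 2))) / (3600 * (L : ℝ) ^ 6)))) ≤
        Ex * Ey * Real.exp (-(β * normSq3 z / (1 + normSq3 z))) := by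
      rw [hEx, hEy, ← Real.exp_add, ← Real.exp_add]
      apply Real.exp_le_exp.2
      have h := mul_le_mul_of_nonneg_left hfloor hb.le
      rw [← hzN]
      have e : -(β * s2 * ((x 1) ^ 2 + (x 2) ^ 2)) + -(β * s2 * ((y 1) ^ 2 + (y 2) ^ 2)) +
          -(β * ((z 0) ^ 2 + (z 1) ^ 2 + (z 2) ^ 2) / (1 + ((z 0) ^ 2 + (z 1) ^ 2 + (z 2) ^ 2))) =
          -(b * (((1 + δt ^ 2)⁻¹ * ((x 1) ^ 2 + (x 2) ^ 2) + (1 + δt ^ 2)⁻¹ * ((y 1) ^ 2 + (y 2) ^ 2) +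
            ((z 0) ^ 2 + (z 1) ^ 2 + (z 2) ^ 2) / (1 + ((z 0) ^ 2 + (z 1) ^ 2 + (z 2) ^ 2))) / (14400 * (L : ℝ) ^ 6))) := by
        rw [hβ, hs2def]; field_simp; ring
      rw [e]
      linarith
    -- combine
    have hwz0 : 0 ≤ gnomonicWeight z := (gnomonicWeight_pos z).le
    have hW0 : 0 ≤ gnomonicWeight x * gnomonicWeight y * gnomonicWeight z := by positivity
    have hmainR : 0 ≤ Real.exp (3 / 2) * Gb / Dref + Real.exp (-(b * κR)) * IW := by positivity
    have step1 : ENNReal.ofReal (gnomonicWeight x * gnomonicWeight y * gnomonicWeight z) *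
        ∫⁻ F : Fol L → Fin 3 → ℝ, ENNReal.ofReal (Real.exp (-(b * gnoDeficit (fun _ => false) (fun _ => 1) (hubAt δt 1) ε (((x, y), (z, F)) : GnoCoord L))) * piWeight F) ≤
        ENNReal.ofReal (gnomonicWeight x * gnomonicWeight y * gnomonicWeight z) *
          (ENNReal.ofReal (Ex * Ey * Real.exp (-(β * normSq3 z / (1 + normSq3 z))) * (Real.exp (3 / 2) * Gb / Dref + Real.exp (-(b * κR)) * IW)) +
            ENNReal.ofReal (Real.exp (-(b * rate))) * ∫⁻ F : Fol L → Fin 3 → ℝ, ENNReal.ofReal (piWeight F)) := by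
      refine mul_le_mul_of_nonneg_left (hfib.trans ?_) bot_le
      exact add_le_add (ENNReal.ofReal_le_ofReal (mul_le_mul_of_nonneg_right hexp hmainR)) le_rfl
    refine step1.trans (le_of_eq ?_)
    have hK0 : 0 ≤ gnomonicWeight x * gnomonicWeight y * Ex * Ey * (Real.exp (3 / 2) * Gb / Dref + Real.exp (-(b * κR)) * IW) := by positivity
    have hwxy0 : 0 ≤ gnomonicWeight x * gnomonicWeight y := by positivity
    have eA : ENNReal.ofReal (gnomonicWeight x * gnomonicWeight y * gnomonicWeight z) *
        ENNReal.ofReal (Ex * Ey * Real.exp (-(β * normSq3 z / (1 + normSq3 z))) * (Real.exp (3 / 2) * Gb / Dref + Real.exp (-(b * κR)) * IW)) =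
        ENNReal.ofReal (gnomonicWeight x * gnomonicWeight y * Ex * Ey * (Real.exp (3 / 2) * Gb / Dref + Real.exp (-(b * κR)) * IW)) *
          ENNReal.ofReal (gnomonicWeight z * Real.exp (-(β * normSq3 z / (1 + normSq3 z)))) := by
      rw [← ENNReal.ofReal_mul hW0, ← ENNReal.ofReal_mul hK0]
      congr 1; ring
    have eB : ENNReal.ofReal (gnomonicWeight x * gnomonicWeight y * gnomonicWeight z) *
        (ENNReal.ofReal (Real.exp (-(b * rate))) * ∫⁻ F : Fol L → Fin 3 → ℝ, ENNReal.ofReal (piWeight F)) =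
        (ENNReal.ofReal (gnomonicWeight x * gnomonicWeight y) * ENNReal.ofReal (Real.exp (-(b * rate)))) *
          (ENNReal.ofReal (gnomonicWeight z) * ∫⁻ F : Fol L → Fin 3 → ℝ, ENNReal.ofReal (piWeight F)) := by
      rw [ENNReal.ofReal_mul hwxy0]; ring
    rw [mul_add, eA, eB]
  -- integrate in `z`
  have hmeas1 : Measurable fun z : Fin 3 → ℝ => ENNReal.ofReal (gnomonicWeight z * Real.exp (-(β * normSq3 z / (1 + normSq3 z)))) := by
    unfold gnomonicWeight normSq3; exact Measurable.ennreal_ofReal (by fun_prop)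
  have hmeas2 : Measurable fun z : Fin 3 → ℝ => ENNReal.ofReal (gnomonicWeight z) := by
    unfold gnomonicWeight normSq3; exact Measurable.ennreal_ofReal (by fun_prop)
  have hZ : ∫⁻ z : Fin 3 → ℝ, ENNReal.ofReal (gnomonicWeight z * Real.exp (-(β * normSq3 z / (1 + normSq3 z)))) ≤ ENNReal.ofReal Zc :=
    lintegral_zLetter_pi_le (c := β) hβ0
  have hWz := Gnomonic.lintegral_gnomonicWeight
  have hLW := lintegral_piWeight_le_exp (L := L)
  -- freeze the letters (no more unfolding)
  clear_value Ex Ey rate IW κR Dref Gb Zc C3 s2 β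
  -- shrink the letters
  have hK10 : 0 ≤ gnomonicWeight x * gnomonicWeight y * Ex * Ey * (Real.exp (3 / 2) * Gb / Dref + Real.exp (-(b * κR)) * IW) := by positivity
  generalize hK1 : gnomonicWeight x * gnomonicWeight y * Ex * Ey * (Real.exp (3 / 2) * Gb / Dref + Real.exp (-(b * κR)) * IW) = K1 at hpt hK10
  generalize hLWdef : (∫⁻ F : Fol L → Fin 3 → ℝ, ENNReal.ofReal (piWeight F)) = LW at hpt hLW
  -- Tonelli-free: monotonicity + constants out
  have hint : ∫⁻ z : Fin 3 → ℝ, ENNReal.ofReal (gnomonicWeight x * gnomonicWeight y * gnomonicWeight z) *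
        ∫⁻ F : Fol L → Fin 3 → ℝ, ENNReal.ofReal (Real.exp (-(b * gnoDeficit (fun _ => false) (fun _ => 1) (hubAt δt 1) ε (((x, y), (z, F)) : GnoCoord L))) * piWeight F) ≤
      ENNReal.ofReal K1 * ENNReal.ofReal Zc +
        (ENNReal.ofReal (gnomonicWeight x * gnomonicWeight y) * ENNReal.ofReal (Real.exp (-(b * rate)))) *
          (ENNReal.ofReal (Real.pi ^ 2) * ENNReal.ofReal (Real.exp (60 * (L : ℝ) ^ 4))) := by
    refine (lintegral_mono hpt).trans ?_
    have e1 : ∫⁻ z : Fin 3 → ℝ, (ENNReal.ofReal K1 * ENNReal.ofReal (gnomonicWeight z * Real.exp (-(β * normSq3 z / (1 + normSq3 z)))) +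
          (ENNReal.ofReal (gnomonicWeight x * gnomonicWeight y) * ENNReal.ofReal (Real.exp (-(b * rate)))) * (ENNReal.ofReal (gnomonicWeight z) * LW)) =
        ENNReal.ofReal K1 * (∫⁻ z : Fin 3 → ℝ, ENNReal.ofReal (gnomonicWeight z * Real.exp (-(β * normSq3 z / (1 + normSq3 z))))) +
          (ENNReal.ofReal (gnomonicWeight x * gnomonicWeight y) * ENNReal.ofReal (Real.exp (-(b * rate)))) *
            ((∫⁻ z : Fin 3 → ℝ, ENNReal.ofReal (gnomonicWeight z)) * LW) := by
      rw [lintegral_add_left (hmeas1.const_mul _), lintegral_const_mul _ hmeas1, lintegral_const_mul _ (hmeas2.mul_const _),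
        lintegral_mul_const _ hmeas2]
    rw [e1, hWz]
    gcongr
  -- repackaging in the reals
  have hrate0 : 0 ≤ Real.exp (-(b * rate)) := (Real.exp_pos _).le
  have hreal : K1 * Zc + gnomonicWeight x * gnomonicWeight y * Real.exp (-(b * rate)) * (Real.pi ^ 2 * Real.exp (60 * (L : ℝ) ^ 4)) ≤
      (1 + (x 0) ^ 2)⁻¹ * (1 + (y 0) ^ 2)⁻¹ / Dref * (Real.exp (3 / 2) * Gb * Zc) * (Ex * Ey) +
        gnomonicWeight x * gnomonicWeight y * (Real.exp (-(b * κR)) * IW * Zc + Real.exp (-(b * rate)) * Real.exp (60 * (L : ℝ) ^ 4) * Real.pi ^ 2) := by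
    rw [← hK1]
    have hinv : 0 ≤ Dref⁻¹ := inv_nonneg.2 hDref0
    -- main: `w(x)w(y) ≤ w₀`
    have hA : gnomonicWeight x * gnomonicWeight y * Ex * Ey * (Real.exp (3 / 2) * Gb / Dref) * Zc ≤
        (1 + (x 0) ^ 2)⁻¹ * (1 + (y 0) ^ 2)⁻¹ / Dref * (Real.exp (3 / 2) * Gb * Zc) * (Ex * Ey) := by
      have hww : gnomonicWeight x * gnomonicWeight y ≤ (1 + (x 0) ^ 2)⁻¹ * (1 + (y 0) ^ 2)⁻¹ := mul_le_mul hwx hwy hwy0 (by positivity)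
      have hR : 0 ≤ Ex * Ey * (Real.exp (3 / 2) * Gb / Dref) * Zc := by positivity
      calc gnomonicWeight x * gnomonicWeight y * Ex * Ey * (Real.exp (3 / 2) * Gb / Dref) * Zc
          = (gnomonicWeight x * gnomonicWeight y) * (Ex * Ey * (Real.exp (3 / 2) * Gb / Dref) * Zc) := by ring
        _ ≤ ((1 + (x 0) ^ 2)⁻¹ * (1 + (y 0) ^ 2)⁻¹) * (Ex * Ey * (Real.exp (3 / 2) * Gb / Dref) * Zc) := mul_le_mul_of_nonneg_right hww hR
        _ = (1 + (x 0) ^ 2)⁻¹ * (1 + (y 0) ^ 2)⁻¹ / Dref * (Real.exp (3 / 2) * Gb * Zc) * (Ex * Ey) := by rw [div_eq_mul_inv, div_eq_mul_inv]; ring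
    -- tail: `Ex·Ey ≤ 1`
    have hB : gnomonicWeight x * gnomonicWeight y * Ex * Ey * (Real.exp (-(b * κR)) * IW) * Zc ≤
        gnomonicWeight x * gnomonicWeight y * (Real.exp (-(b * κR)) * IW * Zc) := by
      have hEE : Ex * Ey ≤ 1 := by
        calc Ex * Ey ≤ 1 * 1 := mul_le_mul hEx1 hEy1 hEy0 zero_le_one
          _ = 1 := one_mul 1
      have h0 : 0 ≤ gnomonicWeight x * gnomonicWeight y * (Real.exp (-(b * κR)) * IW * Zc) := by positivity
      calc gnomonicWeight x * gnomonicWeight y * Ex * Ey * (Real.exp (-(b * κR)) * IW) * Zc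
          = (Ex * Ey) * (gnomonicWeight x * gnomonicWeight y * (Real.exp (-(b * κR)) * IW * Zc)) := by ring
        _ ≤ 1 * (gnomonicWeight x * gnomonicWeight y * (Real.exp (-(b * κR)) * IW * Zc)) := mul_le_mul_of_nonneg_right hEE h0
        _ = gnomonicWeight x * gnomonicWeight y * (Real.exp (-(b * κR)) * IW * Zc) := one_mul _
    have esplit : gnomonicWeight x * gnomonicWeight y * Ex * Ey * (Real.exp (3 / 2) * Gb / Dref + Real.exp (-(b * κR)) * IW) * Zc =
        gnomonicWeight x * gnomonicWeight y * Ex * Ey * (Real.exp (3 / 2) * Gb / Dref) * Zc +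
          gnomonicWeight x * gnomonicWeight y * Ex * Ey * (Real.exp (-(b * κR)) * IW) * Zc := by ring
    rw [esplit]
    linarith [hA, hB]
  -- assemble in `ℝ≥0∞`
  have hP0 : 0 ≤ (1 + (x 0) ^ 2)⁻¹ * (1 + (y 0) ^ 2)⁻¹ / Dref * (Real.exp (3 / 2) * Gb * Zc) := by positivity
  have hQ0 : 0 ≤ gnomonicWeight x * gnomonicWeight y *
      (Real.exp (-(b * κR)) * IW * Zc + Real.exp (-(b * rate)) * Real.exp (60 * (L : ℝ) ^ 4) * Real.pi ^ 2) := by positivity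
  calc ∫⁻ z : Fin 3 → ℝ, ENNReal.ofReal (gnomonicWeight x * gnomonicWeight y * gnomonicWeight z) *
        ∫⁻ F : Fol L → Fin 3 → ℝ, ENNReal.ofReal (Real.exp (-(b * gnoDeficit (fun _ => false) (fun _ => 1) (hubAt δt 1) ε (((x, y), (z, F)) : GnoCoord L))) * piWeight F)
      ≤ ENNReal.ofReal K1 * ENNReal.ofReal Zc +
        (ENNReal.ofReal (gnomonicWeight x * gnomonicWeight y) * ENNReal.ofReal (Real.exp (-(b * rate)))) *
          (ENNReal.ofReal (Real.pi ^ 2) * ENNReal.ofReal (Real.exp (60 * (L : ℝ) ^ 4))) := hint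
    _ = ENNReal.ofReal (K1 * Zc + gnomonicWeight x * gnomonicWeight y * Real.exp (-(b * rate)) * (Real.pi ^ 2 * Real.exp (60 * (L : ℝ) ^ 4))) := by
        rw [← ENNReal.ofReal_mul hK10, ← ENNReal.ofReal_mul (by positivity), ← ENNReal.ofReal_mul (by positivity),
          ← ENNReal.ofReal_mul (by positivity), ← ENNReal.ofReal_add (by positivity) (by positivity)]
    _ ≤ ENNReal.ofReal ((1 + (x 0) ^ 2)⁻¹ * (1 + (y 0) ^ 2)⁻¹ / Dref * (Real.exp (3 / 2) * Gb * Zc) * (Ex * Ey) +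
        gnomonicWeight x * gnomonicWeight y * (Real.exp (-(b * κR)) * IW * Zc + Real.exp (-(b * rate)) * Real.exp (60 * (L : ℝ) ^ 4) * Real.pi ^ 2)) :=
        ENNReal.ofReal_le_ofReal hreal
    _ = _ := by
        rw [ENNReal.ofReal_add (by positivity) hQ0, ENNReal.ofReal_mul hP0, ENNReal.ofReal_mul hEx0]

end Summit.QuantumFields.YangMills.Theorems.SwapVirialDeficit.SectorLaplace

end
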